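import Mathlib
import HarnessLib
import Summits.CriticalPhenomena.CardyFormulaZ2.Theorems.CardyComplexConeEdgeCoherenceLeeYangDefs

/-!
# Stub `stub_division` of line `Sketch` (composition `LeeYang`) for crux `CardyComplexCone.EdgeCoherence`

Route `CardyComplexCone` (sub-problem `CriticalPhenomena/CardyFormulaZ2`), crux
`Summit.CriticalPhenomena.CardyFormulaZ2.Theses.CardyComplexCone.EdgeCoherence` (item stmt-CriticalPhenomena-11385).
Helper file `--supports stmt-CriticalPhenomena-11385`: it proves, by name, the registered stub
`stub_division : Sig.stub_division` of the definitions module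
`Theorems/CardyComplexConeEdgeCoherenceLeeYangDefs.lean`, i.e. **DIVISION** (analytic division under domination
on the transfer region `U_η = arcRegion η`): if `f, g` are holomorphic on `U_η`, `‖f‖ ≤ M‖g‖` on `U_η` and
`‖f‖ ≤ ε‖g‖` on the real segment `|x - 1| < η`, then `f = h·g` with `h` holomorphic on `U_η`, `‖h‖ ≤ M` on `U_η`
and `‖h‖ ≤ ε` on the segment.

## Content and proof

Pure one-variable complex analysis (removable singularities + isolated zeros), no order comparison needed.

* `U_η` is open and preconnected (`isOpen_arcRegion`, `isPreconnected_arcRegion`), so `g` is analytic on a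
  neighbourhood of each of its points (`DifferentiableOn.analyticOnNhd`).
* **Degenerate case.** If `g` vanishes identically near some point of `U_η`, the identity principle
  (`AnalyticOnNhd.eqOn_zero_of_preconnected_of_eventuallyEq_zero`) gives `g ≡ 0` on `U_η`, domination gives
  `f ≡ 0` on `U_η`, and `h := 0` works (`0 ≤ M`, `0 ≤ ε`).
* **Generic case** (`exists_eq_mul_of_norm_le_mul`). Otherwise every point of `U_η` has a punctured neighbourhood
  free of zeros of `g` (`AnalyticAt.eventually_eq_zero_or_eventually_ne_zero`). Off the zero set the quotient
  `q = f/g` is holomorphic and bounded by `M` (domination), so at each isolated zero `z₀` of `g` it has a removable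
  singularity: `q` redefined as `limUnder (𝓝[≠] z₀) q` at `z₀` is holomorphic near `z₀`
  (`Complex.differentiableOn_update_limUnder_of_bddAbove`). The global extension
  `h z := if g z = 0 then limUnder (𝓝[≠] z) q else q z` agrees near every point with one of these local
  extensions, hence is holomorphic on `U_η`; `f = h g` holds off the zero set trivially and AT a zero because
  domination forces `f z₀ = 0` there.
* **Bounds.** `‖h‖ ≤ M` holds off the zero set and passes to the isolated zeros by continuity of `h`
  (`le_of_tendsto` along the punctured neighbourhood filter, which is non-trivial in `ℂ`); on the segment,
  `‖h x‖ ≤ ε` holds at real `x` with `g x ≠ 0` and passes to the (isolated) real zeros by continuity of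
  `t ↦ h t` along the reals (`𝓝[≠] x` on `ℝ` maps into `𝓝[≠] x` on `ℂ`; real fugacities near `1` lie in `U_η`,
  `ofReal_mem_arcRegion`).

Sources: standard (Riemann's removable singularity theorem and the identity principle, e.g. E. C. Titchmarsh,
*The Theory of Functions* §§2.6, 3.2); idea card `Cruxes/EdgeCoherence/Ideas/lee-yang-winding-fugacity.md`
(the alias ratios `R_k = Z(· i^k)/Z` are honest bounded holomorphic functions under `ArcRotatedDomination`).
All analysis is Mathlib; everything is proved inline.
-/

noncomputable section

namespace Summit.CriticalPhenomena.CardyFormulaZ2.Cruxes.EdgeCoherence.LeeYang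

open scoped Topology
open Filter Set Function

/-! ### Analytic division under domination on an open set with isolated zeros of the denominator -/

/-- **Analytic division under domination, generic case.** Let `U ⊆ ℂ` be open, `f, g` holomorphic on `U` with
`‖f‖ ≤ M‖g‖` on `U`, and suppose `g ≠ 0` on a punctured neighbourhood of every point of `U` (its zeros in `U` are
isolated). Then `f = h·g` on `U` for some `h` holomorphic on `U` which equals `f/g` off the zero set of `g`:
off the zero set `f/g` is holomorphic and bounded by `M`, so it has a removable singularity at each zero of `g`
(`Complex.differentiableOn_update_limUnder_of_bddAbove`), and at a zero `z₀` of `g` domination gives `f z₀ = 0`. -/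
theorem exists_eq_mul_of_norm_le_mul {U : Set ℂ} (hUo : IsOpen U) {f g : ℂ → ℂ} {M : ℝ}
    (hf : DifferentiableOn ℂ f U) (hg : DifferentiableOn ℂ g U)
    (hdom : ∀ z ∈ U, ‖f z‖ ≤ M * ‖g z‖) (hB : ∀ z₀ ∈ U, ∀ᶠ z in 𝓝[≠] z₀, g z ≠ 0) :
    ∃ h : ℂ → ℂ, DifferentiableOn ℂ h U ∧ (∀ z ∈ U, f z = h z * g z) ∧
      ∀ z ∈ U, g z ≠ 0 → h z = f z / g z := by
  classical
  -- the quotient off the zero set of `g`, and its extension across the (isolated) zeros of `g`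
  set q : ℂ → ℂ := fun w => f w / g w
  set h : ℂ → ℂ := fun z => if g z = 0 then limUnder (𝓝[≠] z) q else q z
  have h_of_ne : ∀ z, g z ≠ 0 → h z = q z := fun z hz => if_neg hz
  have h_of_eq : ∀ z, g z = 0 → h z = limUnder (𝓝[≠] z) q := fun z hz => if_pos hz
  have hqd : ∀ z ∈ U, g z ≠ 0 → DifferentiableAt ℂ q z := fun z hz hgz =>
    (hf.differentiableAt (hUo.mem_nhds hz)).div (hg.differentiableAt (hUo.mem_nhds hz)) hgz
  have hqb : ∀ z ∈ U, g z ≠ 0 → ‖q z‖ ≤ M := fun z hz hgz => by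
    show ‖f z / g z‖ ≤ M
    rw [norm_div, div_le_iff₀ (norm_pos_iff.2 hgz)]
    exact hdom z hz
  refine ⟨h, fun z₀ hz₀ => DifferentiableAt.differentiableWithinAt ?_, fun z hz => ?_,
    fun z _ hgz => h_of_ne z hgz⟩
  · by_cases hg0 : g z₀ = 0
    · -- removable singularity of `q` at the isolated zero `z₀` of `g`
      have hs : ∀ᶠ z in 𝓝 z₀, (z ≠ z₀ → g z ≠ 0) ∧ z ∈ U :=
        (eventually_nhdsWithin_iff.1 (hB z₀ hz₀)).and (hUo.mem_nhds hz₀)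
      have hsn : {z | (z ≠ z₀ → g z ≠ 0) ∧ z ∈ U} ∈ 𝓝 z₀ := hs
      have hd : DifferentiableOn ℂ q ({z | (z ≠ z₀ → g z ≠ 0) ∧ z ∈ U} \ {z₀}) := fun z hz =>
        (hqd z hz.1.2 (hz.1.1 hz.2)).differentiableWithinAt
      have hb : BddAbove (norm ∘ q '' ({z | (z ≠ z₀ → g z ≠ 0) ∧ z ∈ U} \ {z₀})) :=
        ⟨M, by
          rintro _ ⟨z, hz, rfl⟩
          exact hqb z hz.1.2 (hz.1.1 hz.2)⟩
      refine ((Complex.differentiableOn_update_limUnder_of_bddAbove hsn hd hb).differentiableAt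
        hsn).congr_of_eventuallyEq ?_
      filter_upwards [hs] with z hz
      rcases eq_or_ne z z₀ with rfl | hne
      · rw [update_self]
        exact h_of_eq _ hg0
      · rw [update_of_ne hne]
        exact h_of_ne z (hz.1 hne)
    · -- off the zero set, `h = q` near `z₀`
      refine (hqd z₀ hz₀ hg0).congr_of_eventuallyEq ?_
      filter_upwards [((hg.differentiableAt (hUo.mem_nhds hz₀)).continuousAt).eventually_ne hg0]
        with z hz
      exact h_of_ne z hz
  · by_cases hgz : g z = 0
    · -- at a zero of `g`, domination forces `f z = 0`
      have h0 : f z = 0 := by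
        have := hdom z hz
        rw [hgz, norm_zero, mul_zero] at this
        exact norm_le_zero_iff.1 this
      rw [h0, hgz, mul_zero]
    · rw [h_of_ne z hgz]
      exact (div_mul_cancel₀ (f z) hgz).symm

/-! ### The stub -/

/-- **DIVISION** (stub `stub_division` of the composition `LeeYang`): analytic division under domination on the
transfer region. If `f, g` are holomorphic on `U_η = arcRegion η` (`0 < η ≤ 1/2`), `‖f‖ ≤ M‖g‖` on `U_η` and
`‖f x‖ ≤ ε‖g x‖` for real `x` with `|x - 1| < η` (`0 ≤ M`, `0 ≤ ε`), then `f = h·g` on `U_η` with `h` holomorphic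
on `U_η`, `‖h‖ ≤ M` on `U_η` and `‖h x‖ ≤ ε` on the segment. Degenerate case `g ≡ 0` near a point: identity
principle on the preconnected `U_η`, `h = 0`; generic case: `exists_eq_mul_of_norm_le_mul`, and the two bounds pass
from the complement of the (isolated) zero set of `g` to the zeros by continuity of `h`. -/
theorem stub_division : Sig.stub_division := by
  intro η M ε hη0 hη hM hε f g hf hg hdom hseg
  have hUo : IsOpen (arcRegion η) := isOpen_arcRegion η
  by_cases hA : ∃ z₀ ∈ arcRegion η, ∀ᶠ z in 𝓝 z₀, g z = 0
  · -- Degenerate case: `g` vanishes near a point, hence on the (preconnected) region; then so does `f`.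
    obtain ⟨z₀, hz₀, hz⟩ := hA
    have hg0 : EqOn g 0 (arcRegion η) :=
      (hg.analyticOnNhd hUo).eqOn_zero_of_preconnected_of_eventuallyEq_zero
        (isPreconnected_arcRegion η) hz₀ hz
    have hf0 : ∀ z ∈ arcRegion η, f z = 0 := fun z hz => by
      have := hdom z hz
      rw [hg0 hz, Pi.zero_apply, norm_zero, mul_zero] at this
      exact norm_le_zero_iff.1 this
    exact ⟨fun _ => 0, differentiableOn_const 0, fun z hz => by simp [hf0 z hz],
      fun z _ => by simpa using hM, fun x _ => by simpa using hε⟩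
  · -- Generic case: the zeros of `g` in the region are isolated.
    have hB : ∀ z₀ ∈ arcRegion η, ∀ᶠ z in 𝓝[≠] z₀, g z ≠ 0 := fun z₀ hz₀ =>
      ((hg.analyticOnNhd hUo) z₀ hz₀).eventually_eq_zero_or_eventually_ne_zero.resolve_left
        fun hcon => hA ⟨z₀, hz₀, hcon⟩
    obtain ⟨h, hhd, hfhg, hhq⟩ := exists_eq_mul_of_norm_le_mul hUo hf hg hdom hB
    have hcont : ∀ z ∈ arcRegion η, ContinuousAt h z := fun z hz =>
      (hhd.differentiableAt (hUo.mem_nhds hz)).continuousAt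
    -- off the zero set of `g`, the two bounds on `h = f / g`
    have hbM : ∀ z ∈ arcRegion η, g z ≠ 0 → ‖h z‖ ≤ M := fun z hz hgz => by
      rw [hhq z hz hgz, norm_div, div_le_iff₀ (norm_pos_iff.2 hgz)]
      exact hdom z hz
    have hbε : ∀ x : ℝ, |x - 1| < η → g x ≠ 0 → ‖h x‖ ≤ ε := fun x hx hgx => by
      rw [hhq _ (ofReal_mem_arcRegion hη0 hη hx) hgx, norm_div, div_le_iff₀ (norm_pos_iff.2 hgx)]
      exact hseg x hx
    -- punctured neighbourhoods inside the region avoiding the zeros of `g`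
    have hev : ∀ z₀ ∈ arcRegion η, ∀ᶠ z in 𝓝[≠] z₀, z ∈ arcRegion η ∧ g z ≠ 0 := fun z₀ hz₀ =>
      ((eventually_mem_set.2 (hUo.mem_nhds hz₀)).filter_mono nhdsWithin_le_nhds).and (hB z₀ hz₀)
    refine ⟨h, hhd, hfhg, fun z₀ hz₀ => ?_, fun x hx => ?_⟩
    · -- the bound `M` passes to the isolated zeros of `g` by continuity of `h`
      exact le_of_tendsto ((hcont z₀ hz₀).norm.tendsto.mono_left nhdsWithin_le_nhds)
        ((hev z₀ hz₀).mono fun z hz => hbM z hz.1 hz.2)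
    · -- the bound `ε` passes to the isolated real zeros of `g` by continuity of `t ↦ h t` along the reals
      have hxU : (x : ℂ) ∈ arcRegion η := ofReal_mem_arcRegion hη0 hη hx
      have hc : ContinuousAt (fun t : ℝ => ‖h t‖) x :=
        ((hcont _ hxU).comp Complex.continuous_ofReal.continuousAt).norm
      have ht : Tendsto ((↑) : ℝ → ℂ) (𝓝[≠] x) (𝓝[≠] (x : ℂ)) :=
        Complex.continuous_ofReal.continuousWithinAt.tendsto_nhdsWithin fun t ht => by
          simpa using ht
      have h1 : ∀ᶠ t : ℝ in 𝓝[≠] x, (t : ℂ) ∈ arcRegion η ∧ g t ≠ 0 := ht.eventually (hev _ hxU)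
      have hca : Continuous fun t : ℝ => |t - 1| := (continuous_id.sub continuous_const).abs
      have h2 : ∀ᶠ t : ℝ in 𝓝 x, |t - 1| < η := hca.continuousAt.eventually_lt continuousAt_const hx
      exact le_of_tendsto (hc.tendsto.mono_left nhdsWithin_le_nhds)
        ((h1.and (h2.filter_mono nhdsWithin_le_nhds)).mono fun t ht => hbε t ht.2 ht.1.2)

end Summit.CriticalPhenomena.CardyFormulaZ2.Cruxes.EdgeCoherence.LeeYang

end
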